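import Mathlib
import Summits.PneNP.PneNP.Theorems.OverlapGapAlgebraNoStableSectionSmallBall

/-!
# Route OverlapGapAlgebra, crux `NoStableSection` (stmt-PneNP-2462), line `DartGame`:
# stub `stub_energyBound`, part 1 (abstract per-rung bound)

The counting / real-analysis half of the energy bound of the line `DartGame` (Bresler–Huang,
arXiv:2106.02129, Prop. 5.2 with Props 5.5–5.7 replaced by first appearance + binomial
extremality): for weights `φ : Fin n → (0,1]`, a truncation level `θ` and a rung `ℓ` of
`Y : ℕ → Fin n → Bool`, the number of tuples `I : Fin k → Fin n` whose rung-`ℓ` pattern is new is at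
least `n^k (1 - SB(p₀) - ℓ θ)`, `SB(p) = 2(1-p)^k + k p (1-p)^(k-1)`, `p₀ = (b - 2θ)/(-log θ)`
(`en_rung_abstract`), given `∑ -log φ ≥ n b`, `∑ 1/φ ≤ 2n`, `∑_{Y ℓ i = Y ℓ' i} 1/φ ≤ n`.
Uses the small-ball lemma `dartGameSmallBall` (`OverlapGapAlgebraNoStableSectionSmallBall`).
Part 2 (`OverlapGapAlgebraNoStableSectionEnergy`) instantiates `φ` with conditional pattern
frequencies and proves `stub_energyBound`.
-/

namespace Summit.PneNP.PneNP.Cruxes.NoStableSection.DartGame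
set_option linter.dupNamespace false

open Finset Real

/-! ## Stub En, part 1: the abstract per-rung bound (counting and real analysis only)

Fix a rung `ℓ`, weights `φ : Fin n → ℝ` in `(0, 1]` attached to positions (in the application
`φ i` is the conditional frequency of the bit `Y ℓ i` within the class of `i` over rungs `< ℓ`),
a truncation level `θ ∈ (0,1)` and `L = -log θ`.  A tuple `I : Fin k → Fin n` is *small* if
`∏_r φ (I r) ≤ θ` and *new* if its rung-`ℓ` pattern `(Y ℓ (I r))_r` differs from the rung-`ℓ'`
pattern for every `ℓ' < ℓ`.  Then
* `#{¬ small} ≤ n^k · SB(p₀)` (`en_card_notSmall_le`: `dartGameSmallBall` with uniform weights and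
  scores `X = (p₀/p) · min(-log φ, L)/L`, whose mean is `p₀ = (b - 2θ)/L` as soon as
  `∑ -log φ ≥ n b` and `∑ 1/φ ≤ 2n`, by `log x ≤ x - 1`);
* `#{small ∧ ¬ new} ≤ ℓ θ n^k` (`en_card_small_notNew_le`: a Markov-type bound, using
  `∑_{Y ℓ i = Y ℓ' i} 1/φ i ≤ n`);
whence `#{new} ≥ n^k (1 - SB(p₀) - ℓ θ)` (`en_rung_abstract`). -/

section Aux

variable {n : ℕ}

/-- `∑_{I : Fin k → Fin n} ∏_r f (I r) = (∑_i f i)^k ≤ c ^ k` for `0 ≤ f` with `∑ f ≤ c`. -/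
theorem en_sum_prod_le {k : ℕ} (f : Fin n → ℝ) (hf : ∀ i, 0 ≤ f i) {c : ℝ} (h : ∑ i, f i ≤ c) :
    ∑ I : Fin k → Fin n, ∏ r, f (I r) ≤ c ^ k := by
  rw [← Fintype.sum_pow]
  exact pow_le_pow_left₀ (Finset.sum_nonneg fun i _ => hf i) h k

/-- Markov-type bound: the number of tuples `I` with `∏_r φ (I r) ≤ θ` all of whose entries
satisfy `P` is at most `θ · (∑_{P i} 1/φ i)^k ≤ θ n^k`. -/
theorem en_card_small_forall_le {k : ℕ} (φ : Fin n → ℝ) (hφ0 : ∀ i, 0 < φ i) {θ : ℝ}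
    (hθ : 0 < θ) (P : Fin n → Prop) [DecidablePred P]
    (hP : ∑ i ∈ univ.filter P, (φ i)⁻¹ ≤ n) :
    ((univ.filter fun I : Fin k → Fin n => ∏ r, φ (I r) ≤ θ ∧ ∀ r, P (I r)).card : ℝ) ≤
      θ * (n : ℝ) ^ k := by
  have hg0 : ∀ i, 0 ≤ (if P i then (φ i)⁻¹ else 0 : ℝ) := fun i => by
    split_ifs
    · exact inv_nonneg.2 (hφ0 i).le
    · exact le_rfl
  have hgs : ∑ i, (if P i then (φ i)⁻¹ else 0 : ℝ) ≤ n := by rwa [← Finset.sum_filter]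
  rw [natCast_card_filter]
  calc ∑ I : Fin k → Fin n, (if ∏ r, φ (I r) ≤ θ ∧ ∀ r, P (I r) then (1 : ℝ) else 0)
      ≤ ∑ I : Fin k → Fin n, θ * ∏ r, (if P (I r) then (φ (I r))⁻¹ else 0 : ℝ) := by
        refine Finset.sum_le_sum fun I _ => ?_
        split_ifs with h
        · have hall : ∀ r, (if P (I r) then (φ (I r))⁻¹ else 0 : ℝ) = (φ (I r))⁻¹ := fun r => by
            simp [h.2 r]
          rw [Finset.prod_congr rfl fun r _ => hall r, Finset.prod_inv_distrib, ← div_eq_mul_inv,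
            one_le_div (Finset.prod_pos fun r _ => hφ0 _)]
          exact h.1
        · exact mul_nonneg hθ.le (Finset.prod_nonneg fun r _ => hg0 _)
    _ = θ * ∑ I : Fin k → Fin n, ∏ r, (if P (I r) then (φ (I r))⁻¹ else 0 : ℝ) := by
        rw [Finset.mul_sum]
    _ ≤ θ * (n : ℝ) ^ k :=
        mul_le_mul_of_nonneg_left
          (en_sum_prod_le (fun i => if P i then (φ i)⁻¹ else 0) hg0 hgs) hθ.le

/-- Truncated non-new tuples are rare:
`#{I : ∏ φ(I r) ≤ θ, the rung-ℓ pattern of I repeats an earlier rung} ≤ ℓ θ n^k`. -/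
theorem en_card_small_notNew_le {k : ℕ} (Y : ℕ → Fin n → Bool) (ℓ : ℕ) (φ : Fin n → ℝ)
    (hφ0 : ∀ i, 0 < φ i) {θ : ℝ} (hθ : 0 < θ)
    (hP : ∀ ℓ' < ℓ, ∑ i ∈ univ.filter (fun i => Y ℓ i = Y ℓ' i), (φ i)⁻¹ ≤ n) :
    ((univ.filter fun I : Fin k → Fin n =>
        ∏ r, φ (I r) ≤ θ ∧ ¬ ∀ ℓ' < ℓ, ¬ ∀ r, Y ℓ (I r) = Y ℓ' (I r)).card : ℝ) ≤
      ℓ * θ * (n : ℝ) ^ k := by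
  calc ((univ.filter fun I : Fin k → Fin n =>
        ∏ r, φ (I r) ≤ θ ∧ ¬ ∀ ℓ' < ℓ, ¬ ∀ r, Y ℓ (I r) = Y ℓ' (I r)).card : ℝ)
      ≤ (((range ℓ).biUnion fun ℓ' => univ.filter fun I : Fin k → Fin n =>
          ∏ r, φ (I r) ≤ θ ∧ ∀ r, Y ℓ (I r) = Y ℓ' (I r)).card : ℝ) := by
        have hsub : (univ.filter fun I : Fin k → Fin n =>
            ∏ r, φ (I r) ≤ θ ∧ ¬ ∀ ℓ' < ℓ, ¬ ∀ r, Y ℓ (I r) = Y ℓ' (I r)) ⊆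
            (range ℓ).biUnion fun ℓ' => univ.filter fun I : Fin k → Fin n =>
              ∏ r, φ (I r) ≤ θ ∧ ∀ r, Y ℓ (I r) = Y ℓ' (I r) := by
          intro I hI
          simp only [mem_filter, mem_univ, true_and] at hI
          obtain ⟨hsmall, hnot⟩ := hI
          push Not at hnot
          obtain ⟨ℓ', hℓ', hmatch⟩ := hnot
          simp only [mem_biUnion, mem_range, mem_filter, mem_univ, true_and]
          exact ⟨ℓ', hℓ', hsmall, hmatch⟩
        exact_mod_cast card_le_card hsub
    _ ≤ ∑ ℓ' ∈ range ℓ, ((univ.filter fun I : Fin k → Fin n =>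
          ∏ r, φ (I r) ≤ θ ∧ ∀ r, Y ℓ (I r) = Y ℓ' (I r)).card : ℝ) := by
        exact_mod_cast card_biUnion_le
    _ ≤ ∑ ℓ' ∈ range ℓ, θ * (n : ℝ) ^ k :=
        sum_le_sum fun ℓ' hℓ' =>
          en_card_small_forall_le φ hφ0 hθ (fun i => Y ℓ i = Y ℓ' i) (hP ℓ' (mem_range.1 hℓ'))
    _ = ℓ * θ * (n : ℝ) ^ k := by rw [sum_const, card_range, nsmul_eq_mul]; ring

/-- Pointwise truncation loss: `u - θ/φ ≤ min u L` for `u = -log φ`, `L = -log θ`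
(by `log x ≤ x - 1` at `x = θ/φ`). -/
theorem en_min_ge {φ θ : ℝ} (hφ : 0 < φ) (hθ : 0 < θ) :
    -Real.log φ - θ * φ⁻¹ ≤ min (-Real.log φ) (-Real.log θ) := by
  refine le_min ?_ ?_
  · have : 0 ≤ θ * φ⁻¹ := mul_nonneg hθ.le (inv_nonneg.2 hφ.le)
    linarith
  · have h := Real.log_le_sub_one_of_pos (div_pos hθ hφ)
    rw [Real.log_div hθ.ne' hφ.ne'] at h
    rw [← div_eq_mul_inv]
    linarith

/-- Outside the small ball the log-sum is short: `θ < ∏ φ(I r)` forces `∑_r -log φ(I r) < L`. -/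
theorem en_sum_neglog_lt {k : ℕ} (φ : Fin n → ℝ) (hφ0 : ∀ i, 0 < φ i) {θ : ℝ} (hθ : 0 < θ)
    (I : Fin k → Fin n) (h : ¬ ∏ r, φ (I r) ≤ θ) :
    ∑ r, -Real.log (φ (I r)) < -Real.log θ := by
  rw [Finset.sum_neg_distrib, ← Real.log_prod (fun r _ => (hφ0 (I r)).ne'), neg_lt_neg_iff]
  exact Real.log_lt_log hθ (not_le.1 h)

/-- The small-ball estimate: `#{I : ¬ ∏ φ(I r) ≤ θ} ≤ n^k · SB(p₀)`, `p₀ = (b - 2θ)/L`, from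
`dartGameSmallBall` with uniform weights and scores `X = (p₀/p) · min(-log φ, L)/L`. -/
theorem en_card_notSmall_le {k : ℕ} (φ : Fin n → ℝ) (hφ0 : ∀ i, 0 < φ i) (hφ1 : ∀ i, φ i ≤ 1)
    {θ b : ℝ} (hθ : 0 < θ) (hθ1 : θ < 1) (hb : 2 * θ ≤ b) (hn : 1 ≤ n)
    (H1 : n * b ≤ ∑ i, -Real.log (φ i)) (H2 : ∑ i, (φ i)⁻¹ ≤ 2 * n) :
    ((univ.filter fun I : Fin k → Fin n => ¬ ∏ r, φ (I r) ≤ θ).card : ℝ) ≤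
      (n : ℝ) ^ k * (2 * (1 - (b - 2 * θ) / (-Real.log θ)) ^ k +
        k * ((b - 2 * θ) / (-Real.log θ)) * (1 - (b - 2 * θ) / (-Real.log θ)) ^ (k - 1)) := by
  have hL : 0 < -Real.log θ := neg_pos.2 (Real.log_neg hθ hθ1)
  set L : ℝ := -Real.log θ with hLdef
  set p₀ : ℝ := (b - 2 * θ) / L with hp₀
  have hnr : (0 : ℝ) < n := by exact_mod_cast hn
  have hp₀0 : 0 ≤ p₀ := div_nonneg (by linarith) hL.le
  -- truncated scores `x i = min (u i) L / L ∈ [0, 1]` and their mean `p`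
  set x : Fin n → ℝ := fun i => min (-Real.log (φ i)) L / L with hx
  have hx0 : ∀ i, 0 ≤ x i := fun i =>
    div_nonneg (le_min (neg_nonneg.2 (Real.log_nonpos (hφ0 i).le (hφ1 i))) hL.le) hL.le
  have hx1 : ∀ i, x i ≤ 1 := fun i => (div_le_one hL).2 (min_le_right _ _)
  set p : ℝ := ∑ i, (n : ℝ)⁻¹ * x i with hp
  have hp0 : 0 ≤ p := Finset.sum_nonneg fun i _ => mul_nonneg (inv_nonneg.2 hnr.le) (hx0 i)
  -- the mean bound `p₀ ≤ p`
  have hsum : n * b - 2 * θ * n ≤ ∑ i, min (-Real.log (φ i)) L := by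
    calc n * b - 2 * θ * n ≤ ∑ i, -Real.log (φ i) - θ * ∑ i, (φ i)⁻¹ := by nlinarith
      _ = ∑ i, (-Real.log (φ i) - θ * (φ i)⁻¹) := by
          rw [Finset.sum_sub_distrib, Finset.mul_sum]
      _ ≤ ∑ i, min (-Real.log (φ i)) L := Finset.sum_le_sum fun i _ => en_min_ge (hφ0 i) hθ
  have hpL : p * (L * n) = ∑ i, min (-Real.log (φ i)) L := by
    rw [hp, Finset.sum_mul]
    refine Finset.sum_congr rfl fun i _ => ?_
    simp only [hx]
    field_simp
  have hp₀p : p₀ ≤ p := by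
    rw [hp₀, div_le_iff₀ hL]
    have h1 : (n * b - 2 * θ * n) ≤ p * (L * n) := by rw [hpL]; exact hsum
    have h2 : (b - 2 * θ) * n ≤ (p * L) * n := by linarith
    exact le_of_mul_le_mul_right h2 hnr
  -- scaled scores `X i = c * x i ∈ [0,1]`, `c = p₀ / p`, with mean exactly `p₀`
  set c : ℝ := p₀ / p with hc
  have hc0 : 0 ≤ c := div_nonneg hp₀0 hp0
  have hc1 : c ≤ 1 := div_le_one_of_le₀ hp₀p hp0
  have hX : ∀ i, c * x i ∈ Set.Icc (0 : ℝ) 1 := fun i =>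
    ⟨mul_nonneg hc0 (hx0 i), by nlinarith [hx0 i, hx1 i]⟩
  have hmean : ∑ i, (n : ℝ)⁻¹ * (c * x i) = p₀ := by
    have : ∑ i, (n : ℝ)⁻¹ * (c * x i) = c * p := by
      rw [hp, Finset.mul_sum]
      exact Finset.sum_congr rfl fun i _ => by ring
    rw [this, hc]
    rcases eq_or_lt_of_le hp0 with h0 | hpos
    · have hz : p₀ = 0 := le_antisymm (h0 ▸ hp₀p) hp₀0
      rw [hz]; simp
    · exact div_mul_cancel₀ p₀ hpos.ne'
  have hw : ∀ _i : Fin n, 0 ≤ (n : ℝ)⁻¹ := fun _ => inv_nonneg.2 hnr.le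
  have hw1 : ∑ _i : Fin n, (n : ℝ)⁻¹ = 1 := by
    rw [Finset.sum_const, Finset.card_univ, Fintype.card_fin, nsmul_eq_mul,
      mul_inv_cancel₀ hnr.ne']
  -- the small-ball lemma
  have hSB := dartGameSmallBall k n (fun _ => (n : ℝ)⁻¹) (fun i => c * x i) hw hw1 hX
  rw [hmean] at hSB
  -- its left side is `#{I : ∑ X < 1} · n⁻ᵏ`
  have hlhs : ∑ ω ∈ (univ : Finset (Fin k → Fin n)).filter (fun ω => ∑ r, c * x (ω r) < 1),
      ∏ _r : Fin k, (n : ℝ)⁻¹ =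
      ((univ.filter fun ω : Fin k → Fin n => ∑ r, c * x (ω r) < 1).card : ℝ) *
        ((n : ℝ)⁻¹) ^ k := by
    rw [Finset.sum_const, nsmul_eq_mul, Finset.prod_const, Finset.card_univ, Fintype.card_fin]
  -- containment `{¬ small} ⊆ {∑ X < 1}`
  have hsub : (univ.filter fun I : Fin k → Fin n => ¬ ∏ r, φ (I r) ≤ θ) ⊆
      univ.filter fun ω : Fin k → Fin n => ∑ r, c * x (ω r) < 1 := by
    intro I hI
    simp only [mem_filter, mem_univ, true_and] at hI ⊢
    have hlt := en_sum_neglog_lt φ hφ0 hθ I hI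
    calc ∑ r, c * x (I r) ≤ ∑ r, x (I r) :=
          Finset.sum_le_sum fun r _ => by nlinarith [hx0 (I r), hc0, hc1]
      _ ≤ ∑ r, -Real.log (φ (I r)) / L :=
          Finset.sum_le_sum fun r _ => div_le_div_of_nonneg_right (min_le_left _ _) hL.le
      _ = (∑ r, -Real.log (φ (I r))) / L := by rw [Finset.sum_div]
      _ < 1 := (div_lt_one hL).2 hlt
  -- conclude
  have hnk : (0 : ℝ) < (n : ℝ) ^ k := pow_pos hnr k
  calc ((univ.filter fun I : Fin k → Fin n => ¬ ∏ r, φ (I r) ≤ θ).card : ℝ)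
      ≤ ((univ.filter fun ω : Fin k → Fin n => ∑ r, c * x (ω r) < 1).card : ℝ) := by
        exact_mod_cast card_le_card hsub
    _ = (∑ ω ∈ (univ : Finset (Fin k → Fin n)).filter (fun ω => ∑ r, c * x (ω r) < 1),
          ∏ _r : Fin k, (n : ℝ)⁻¹) * (n : ℝ) ^ k := by
        rw [hlhs, mul_assoc, ← mul_pow, inv_mul_cancel₀ hnr.ne', one_pow, mul_one]
    _ ≤ (2 * (1 - p₀) ^ k + k * p₀ * (1 - p₀) ^ (k - 1)) * (n : ℝ) ^ k :=
        mul_le_mul_of_nonneg_right hSB hnk.le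
    _ = (n : ℝ) ^ k * (2 * (1 - p₀) ^ k + k * p₀ * (1 - p₀) ^ (k - 1)) := mul_comm _ _

/-- **Abstract per-rung bound**: `#{I new at rung ℓ} ≥ n^k (1 - SB(p₀) - ℓ θ)`. -/
theorem en_rung_abstract {k : ℕ} (ℓ : ℕ) (Y : ℕ → Fin n → Bool) (φ : Fin n → ℝ)
    (hφ0 : ∀ i, 0 < φ i) (hφ1 : ∀ i, φ i ≤ 1) {θ b : ℝ} (hθ : 0 < θ) (hθ1 : θ < 1)
    (hb : 2 * θ ≤ b) (hn : 1 ≤ n) (H1 : n * b ≤ ∑ i, -Real.log (φ i))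
    (H2 : ∑ i, (φ i)⁻¹ ≤ 2 * n)
    (H3 : ∀ ℓ' < ℓ, ∑ i ∈ univ.filter (fun i => Y ℓ i = Y ℓ' i), (φ i)⁻¹ ≤ n) :
    (n : ℝ) ^ k * (1 - (2 * (1 - (b - 2 * θ) / (-Real.log θ)) ^ k +
        k * ((b - 2 * θ) / (-Real.log θ)) * (1 - (b - 2 * θ) / (-Real.log θ)) ^ (k - 1)) -
          ℓ * θ) ≤
      ((univ.filter fun I : Fin k → Fin n =>
        ∀ ℓ' < ℓ, ¬ ∀ r, Y ℓ (I r) = Y ℓ' (I r)).card : ℝ) := by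
  have hA := en_card_notSmall_le (k := k) φ hφ0 hφ1 hθ hθ1 hb hn H1 H2
  have hB := en_card_small_notNew_le (k := k) Y ℓ φ hφ0 hθ H3
  have h1 := card_filter_add_card_filter_not (s := (univ : Finset (Fin k → Fin n)))
    (fun I => ∏ r, φ (I r) ≤ θ)
  have h2 := card_filter_add_card_filter_not
    (s := univ.filter fun I : Fin k → Fin n => ∏ r, φ (I r) ≤ θ)
    (fun I => ∀ ℓ' < ℓ, ¬ ∀ r, Y ℓ (I r) = Y ℓ' (I r))
  rw [filter_filter, filter_filter] at h2
  have h3 : (univ.filter fun I : Fin k → Fin n =>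
      ∏ r, φ (I r) ≤ θ ∧ ∀ ℓ' < ℓ, ¬ ∀ r, Y ℓ (I r) = Y ℓ' (I r)).card ≤
      (univ.filter fun I : Fin k → Fin n => ∀ ℓ' < ℓ, ¬ ∀ r, Y ℓ (I r) = Y ℓ' (I r)).card := by
    refine card_le_card fun I hI => ?_
    simp only [mem_filter, mem_univ, true_and] at hI ⊢
    exact hI.2
  have hU : (univ : Finset (Fin k → Fin n)).card = n ^ k := by
    rw [Finset.card_univ, Fintype.card_fun, Fintype.card_fin, Fintype.card_fin]
  rw [hU] at h1
  have h1' : (((univ.filter fun I : Fin k → Fin n => ∏ r, φ (I r) ≤ θ).card : ℕ) : ℝ) +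
      ((univ.filter fun I : Fin k → Fin n => ¬ ∏ r, φ (I r) ≤ θ).card : ℝ) = (n : ℝ) ^ k := by
    exact_mod_cast h1
  have h2' : ((univ.filter fun I : Fin k → Fin n =>
        ∏ r, φ (I r) ≤ θ ∧ ∀ ℓ' < ℓ, ¬ ∀ r, Y ℓ (I r) = Y ℓ' (I r)).card : ℝ) +
      ((univ.filter fun I : Fin k → Fin n =>
        ∏ r, φ (I r) ≤ θ ∧ ¬ ∀ ℓ' < ℓ, ¬ ∀ r, Y ℓ (I r) = Y ℓ' (I r)).card : ℝ) =
      ((univ.filter fun I : Fin k → Fin n => ∏ r, φ (I r) ≤ θ).card : ℝ) := by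
    exact_mod_cast h2
  have h3' : ((univ.filter fun I : Fin k → Fin n =>
      ∏ r, φ (I r) ≤ θ ∧ ∀ ℓ' < ℓ, ¬ ∀ r, Y ℓ (I r) = Y ℓ' (I r)).card : ℝ) ≤
      ((univ.filter fun I : Fin k → Fin n => ∀ ℓ' < ℓ, ¬ ∀ r, Y ℓ (I r) = Y ℓ' (I r)).card : ℝ) := by
    exact_mod_cast h3
  nlinarith [hA, hB, h1', h2', h3']

/-- The ∀-closed form of `en_rung_abstract` (all binders explicit), registered as the helper stub
`stub_energyRungAbstract` of stmt-PneNP-2462 that this file proves verbatim. -/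
theorem stub_energyRungAbstract : ∀ (n k ℓ : ℕ) (Y : ℕ → Fin n → Bool) (φ : Fin n → ℝ) (θ b : ℝ),
    (∀ i, 0 < φ i) → (∀ i, φ i ≤ 1) → 0 < θ → θ < 1 → 2 * θ ≤ b → 1 ≤ n →
    (n : ℝ) * b ≤ ∑ i, -Real.log (φ i) → ∑ i, (φ i)⁻¹ ≤ 2 * (n : ℝ) →
    (∀ ℓ' < ℓ, ∑ i ∈ Finset.univ.filter (fun i => Y ℓ i = Y ℓ' i), (φ i)⁻¹ ≤ (n : ℝ)) →
    (n : ℝ) ^ k * (1 - (2 * (1 - (b - 2 * θ) / (-Real.log θ)) ^ k +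
        k * ((b - 2 * θ) / (-Real.log θ)) * (1 - (b - 2 * θ) / (-Real.log θ)) ^ (k - 1)) -
          ℓ * θ) ≤
      ((Finset.univ.filter fun I : Fin k → Fin n =>
        ∀ ℓ' < ℓ, ¬ ∀ r, Y ℓ (I r) = Y ℓ' (I r)).card : ℝ) :=
  fun _n _k ℓ Y φ _θ _b h0 h1 hθ hθ1 hb hn H1 H2 H3 =>
    en_rung_abstract ℓ Y φ h0 h1 hθ hθ1 hb hn H1 H2 H3

end Aux

end Summit.PneNP.PneNP.Cruxes.NoStableSection.DartGame
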